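import Summits.QuantumFields.BalabanUV.Beta.D1BFx.NeedleGhostBubblePointwise
import Summits.QuantumFields.BalabanUV.Beta.D1BFx.RColumnBlockMass

/-!
# `BalabanUV.Beta.D1BFx.NeedleGhostDipoleWord` — road «BF-x» for binder row D1, slot (K), END row `hGrp gN`, (N-2) rows «NT-4» ∕ «NT-5» WITH TOLERANCE `n¹⁰`
# (cell T₄-ii ∕ T₅-ii of `END-ii-SPEC.md` v1.1 §3 (c), owner ruling ρ-g11-11 (4)(c)), FILE W: **THE GHOST NEEDLE BUBBLES `ghCur ⊗ qA` ∕ `qA ⊗ ghCur` OVER THE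
# SCALAR GHOST LEGS, READ AS A DIPOLE** — the record's closed form `NeedleGhostBubblePointwise.biBubble_ghCur_qAntiAt` REGROUPED ACROSS THE CURRENT'S BOND
# (`R·∇γ − ∇R·γ − ρ·∇C + ∇ρ·C`) and bounded through the POINTWISE letters of the ghost leg (`GhostLegFree.ghost_d0∕ghost_d1`, `GhostLegBlockMassD1.abs_Ggh_le_sharp`,
# the block masses M10 `GhostLegBlockMass.sum_B_abs_Ggh_le` and M10-d1 `GhostLegBlockMassD1.sum_B_abs_Ggh_diff_le∕_col_le`): for EVERY root `ρ`, axes, sites,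
# `|T₄(p,u)|, |T₅(u,p)| ≤ Σ_{x ∈ B(blk u)} |qJetAt ρ n λ u (blk u) x| · n⁻²·(cNear·A₁·e(p−x)∕nrm(p−x)³ + (cNear1∕n)·A₀·e(p−x)∕nrm(p−x)²)`, `e(v) = e^{−(ghDelta a∕n)|v|_∞}` —
# one inverse power SHARPER than the record's block-mass letter (`n⁻⁴·m·m`), which is what the `n¹⁰` tolerance needs

HONEST DEPENDENCY (cell records, verbatim): «continuum YM on T⁴ ⇐ BetaPertH ∧ nine spine estimates (0/9 proved); BetaPertH ⇐ (D1) ∧ (D4) ∧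
CAP+tail; G-an2-4 gates asym, D1 and NE2/3/4.»  HONEST FRAMING (cell contract, verbatim): «discharging `BetaPertH` makes Bałaban's UV stability
UNCONDITIONAL — a real constructive-QFT result; it is NOT the continuum limit and NOT the Clay problem.»  THIS MODULE DISCHARGES NOTHING of the wall:
[folklore] lattice bookkeeping BY NAME over gan24-leaf-05's `NeedleGhostBubblePointwise` (closed forms), an3∕gan24-leaf-05's ghost-leg letters (`ghost_d0`, `ghost_d1`,
`abs_Ggh_le_sharp`, `abs_Ggh_le_of_ne`, `abs_Ggh_diff_le_of_ne`, M10, M10-d1), `RColumnBlockMass.cNear_nonneg` and `GhostLeg.Ggh_symm`.  No `def`, no `def … : Prop`, nothing cited, 0 sorry;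
HYPOTHESIS-FREE beyond `0 < a`.  Asserts nothing of Bałaban's.  Root-level binders hW ∕ hR-sockets ∕ hSX-socket ∕ D1Tel ∕ D1Rep — 0 discharged; (K) NOT closed;
NOT D1, NOT `BetaPertH`, NOT continuum, NOT Clay.  END-AGNOSTIC: no `hω`, no `s`, no END-ii name (the weight letter enters only in FILE R).

ABSOLUTE RULE (cell charter, verbatim): «No internally-minted statement may enter as a cited fact. Every hypothesis is either kernel-proved in this
package or a verbatim quotation of a PUBLISHED theorem with page reference. The manuscript(s) under audit are NOT citable for their own disputed
steps — they are the thing under adjudication; programme-internal (2001/route/tribunal) claims are never citable.»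

CONTENT (all [folklore]; `B := B (n−1) (blk (n−1) u)`, `e(v) := exp (−(ghDelta a ∕ n)·supNorm v)`, `A₀ := ghA0 a + (cG0 4 + cSplit 4 a)`, `A₁ := ghA1 a + 2·(cG0 4 + cSplit 4 a)`):
* §1 unified pointwise envelopes of the ghost leg, ALL offsets (diagonal included): `abs_Ggh_le_env` (`|Ggh x y| ≤ n⁻²·A₀·e(x−y)∕nrm(x−y)²`),
  `abs_Ggh_rowDiff_le_env` (`|Ggh (x+e_κ) y − Ggh x y| ≤ n⁻²·A₁·e(x−y)∕nrm(x−y)³`), `abs_Ggh_colDiff_le_env` (the column twin by `Ggh_symm`), evenness `env_symm'`.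
* §2 the needle-weighted leg sums: `abs_gam_le` ∕ `abs_gam_diff_le` (`γ(y) = Σ_{x∈B} Ggh x y·q x`), `abs_rho_le` ∕ `abs_rho_diff_le` (`ρ(y) = Σ_{t∈B} Ggh y t·q t`),
  the block sums `abs_R_le` ∕ `abs_R_diff_le` (rows, `≤ cNear`, `≤ cNear1∕n`), `abs_C_le` ∕ `abs_C_diff_le` (columns).
* §3 the dipole regrouping `dipole_regroup` (ring identity) and **`abs_T₄_le_needle_env`**, **`abs_T₅_le_needle_env`**.
NOT HERE (honest): the (1.22) sum, the base-point average, the weight letter — FILE R `NeedleGhostBubbleRowMass10`.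
Unit `b2b-balaban-beta-d1-formalise-leaf-01` (gen 16), D1 formalisation swarm LEAF PROVER 01; `LEAVES-BFx.md` row (N) ∕ (N-2) «NT-4»∕«NT-5», cell T₄-ii∕T₅-ii.
-/

noncomputable section

namespace Summit.QuantumFields.BalabanUV.Beta.D1BFx.NeedleGhostDipoleWord

open Finset Real
open scoped BigOperators
open Literature.MathematicalPhysics.QuantumFieldTheory.Balaban1983to89
open Literature.MathematicalPhysics.QuantumFieldTheory.Balaban1983to89.Beta
open B6QGQLower276 (blk B mem_B)
open Beta.PoissonInterior (nrm one_le_nrm nrm_pos nrm_neg supNorm_le_nrm supNorm_eq_zero_iff)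
open DyadicShell (Pt supNorm)
open ExpKernelCalculus (Site MKer)
open AffineAveraging (unitVec)
open GhostStencil (ghCur)
open Summit.QuantumFields.BalabanUV.Beta.D1BFx.FineHessianSectors (biBubbleTable)
open Summit.QuantumFields.BalabanUV.Beta.D1BFx.GhostStencilRooted (qJetAt qAntiAt)
open Summit.QuantumFields.BalabanUV.Beta.D1BFx.GhostLeg (Ggh Ggh_symm)
open Summit.QuantumFields.BalabanUV.Beta.D1BFx.PointColumnSplit (cG0 cG0_nonneg cSplit cSplit_nonneg)
open Summit.QuantumFields.BalabanUV.Beta.D1BFx.GhostLegFree (ghA0 ghA1 ghDelta ghDelta_pos nrm_eq_supNorm)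
open Summit.QuantumFields.BalabanUV.Beta.D1BFx.GhostLegBlockMass (cNear ghA0_pos abs_Ggh_le_of_ne sum_B_abs_Ggh_le)
open Summit.QuantumFields.BalabanUV.Beta.D1BFx.GhostLegBlockMassD1 (cNear1 ghA1_nonneg abs_Ggh_le_sharp abs_Ggh_diff_le_of_ne sum_B_abs_Ggh_diff_le
  sum_B_abs_Ggh_diff_col_le)
open Summit.QuantumFields.BalabanUV.Beta.D1BFx.NeedleGhostBubblePointwise (biBubbleTable_ghCur_qAntiAt_eq biBubbleTable_qAntiAt_ghCur_eq)
open Summit.QuantumFields.BalabanUV.Beta.D1BFx.RColumnBlockMass (cNear_nonneg)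

variable (n : ℕ) [NeZero n] {a : ℝ}

/-! ## §1 Unified pointwise envelopes of the ghost leg (every offset, the diagonal included) -/

omit [NeZero n] in
/-- [folklore] The envelopes are even: `e(x−y)∕nrm(x−y)ᵏ = e(y−x)∕nrm(y−x)ᵏ`. -/
theorem env_symm' (k : ℕ) (x y : Pt) :
    Real.exp (-(ghDelta a / n) * supNorm (x - y)) / nrm (x - y) ^ k = Real.exp (-(ghDelta a / n) * supNorm (y - x)) / nrm (y - x) ^ k := by
  have e1 : supNorm (x - y) = supNorm (y - x) := by
    rw [show x - y = -(y - x) by abel]; exact PoissonInterior.supNorm_neg (d := 4) (y - x)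
  have e2 : nrm (x - y) = nrm (y - x) := by rw [show x - y = -(y - x) by abel, nrm_neg]
  rw [e1, e2]

/-- [folklore] **THE GHOST LEG, EVERY OFFSET**: `|Ggh x y| ≤ n⁻²·(ghA0 a + (cG0 4 + cSplit 4 a))·e(x−y)∕nrm(x−y)²` — `ghost_d0` off the diagonal (`nrm = |·|_∞` there),
`abs_Ggh_le_sharp` on it (`e(0) = 1`, `nrm 0 = 1`). -/
theorem abs_Ggh_le_env (ha : 0 < a) (x y : Pt) :
    |Ggh n a x y () ()| ≤ ((n : ℝ) ^ 2)⁻¹ * (ghA0 a + (cG0 4 + cSplit 4 a)) * (Real.exp (-(ghDelta a / n) * supNorm (x - y)) / nrm (x - y) ^ 2) := by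
  have hn : (0 : ℝ) < n := by exact_mod_cast Nat.pos_of_ne_zero (NeZero.ne n)
  have hA0 : 0 ≤ ghA0 a := (ghA0_pos ha).le
  have hc : 0 ≤ cG0 4 + cSplit 4 a := add_nonneg (cG0_nonneg 4) (cSplit_nonneg 4 ha)
  by_cases hxy : x = y
  · subst hxy
    have h := abs_Ggh_le_sharp n ha x x
    have e0 : supNorm (x - x) = 0 := by rw [sub_self]; exact DyadicShell.supNorm_eq_zero_iff.2 rfl
    have e1 : nrm (x - x) = 1 := by
      rw [sub_self]; unfold nrm; rw [PoissonInterior.supNorm_zero]; simp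
    rw [e0, e1]
    simp only [Nat.cast_zero, mul_zero, Real.exp_zero, one_pow, div_one, mul_one]
    calc |Ggh n a x x () ()| ≤ (cG0 4 + cSplit 4 a) / (n : ℝ) ^ 2 := h
      _ = ((n : ℝ) ^ 2)⁻¹ * (cG0 4 + cSplit 4 a) := by rw [div_eq_inv_mul]
      _ ≤ ((n : ℝ) ^ 2)⁻¹ * (ghA0 a + (cG0 4 + cSplit 4 a)) := mul_le_mul_of_nonneg_left (by linarith) (by positivity)
  · have h := abs_Ggh_le_of_ne n ha hxy
    have hv : x - y ≠ 0 := sub_ne_zero.2 hxy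
    have hN : nrm (x - y) = (supNorm (x - y) : ℝ) := nrm_eq_supNorm hv
    have hNp : (0 : ℝ) < (supNorm (x - y) : ℝ) := by rw [← hN]; exact nrm_pos _
    rw [hN]
    calc |Ggh n a x y () ()| ≤ ghA0 a * Real.exp (-(ghDelta a / n) * supNorm (x - y)) / ((n : ℝ) ^ 2 * (supNorm (x - y) : ℝ) ^ 2) := h
      _ = ((n : ℝ) ^ 2)⁻¹ * ghA0 a * (Real.exp (-(ghDelta a / n) * supNorm (x - y)) / (supNorm (x - y) : ℝ) ^ 2) := by
          field_simp
      _ ≤ ((n : ℝ) ^ 2)⁻¹ * (ghA0 a + (cG0 4 + cSplit 4 a)) * (Real.exp (-(ghDelta a / n) * supNorm (x - y)) / (supNorm (x - y) : ℝ) ^ 2) :=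
          mul_le_mul_of_nonneg_right (mul_le_mul_of_nonneg_left (by linarith) (by positivity)) (by positivity)

/-- [folklore] **THE GHOST LEG's ROW DIFFERENCE, EVERY OFFSET**: `|Ggh (x+e_κ) y − Ggh x y| ≤ n⁻²·(ghA1 a + 2·(cG0 4 + cSplit 4 a))·e(x−y)∕nrm(x−y)³`. -/
theorem abs_Ggh_rowDiff_le_env (ha : 0 < a) (x y : Pt) (κ : Fin 4) :
    |Ggh n a (x + unitVec κ) y () () - Ggh n a x y () ()|
      ≤ ((n : ℝ) ^ 2)⁻¹ * (ghA1 a + 2 * (cG0 4 + cSplit 4 a)) * (Real.exp (-(ghDelta a / n) * supNorm (x - y)) / nrm (x - y) ^ 3) := by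
  have hn : (0 : ℝ) < n := by exact_mod_cast Nat.pos_of_ne_zero (NeZero.ne n)
  have hA1 : 0 ≤ ghA1 a := ghA1_nonneg ha
  have hc : 0 ≤ cG0 4 + cSplit 4 a := add_nonneg (cG0_nonneg 4) (cSplit_nonneg 4 ha)
  by_cases hxy : x = y
  · subst hxy
    have h1 := abs_Ggh_le_sharp n ha (x + unitVec κ) x
    have h2 := abs_Ggh_le_sharp n ha x x
    have e0 : supNorm (x - x) = 0 := by rw [sub_self]; exact DyadicShell.supNorm_eq_zero_iff.2 rfl
    have e1 : nrm (x - x) = 1 := by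
      rw [sub_self]; unfold nrm; rw [PoissonInterior.supNorm_zero]; simp
    rw [e0, e1]
    simp only [Nat.cast_zero, mul_zero, Real.exp_zero, one_pow, div_one, mul_one]
    calc |Ggh n a (x + unitVec κ) x () () - Ggh n a x x () ()| ≤ |Ggh n a (x + unitVec κ) x () ()| + |Ggh n a x x () ()| := abs_sub _ _
      _ ≤ (cG0 4 + cSplit 4 a) / (n : ℝ) ^ 2 + (cG0 4 + cSplit 4 a) / (n : ℝ) ^ 2 := add_le_add h1 h2
      _ = ((n : ℝ) ^ 2)⁻¹ * (2 * (cG0 4 + cSplit 4 a)) := by rw [div_eq_inv_mul]; ring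
      _ ≤ ((n : ℝ) ^ 2)⁻¹ * (ghA1 a + 2 * (cG0 4 + cSplit 4 a)) := mul_le_mul_of_nonneg_left (by linarith) (by positivity)
  · have h := abs_Ggh_diff_le_of_ne n ha hxy κ
    have hv : x - y ≠ 0 := sub_ne_zero.2 hxy
    have hN : nrm (x - y) = (supNorm (x - y) : ℝ) := nrm_eq_supNorm hv
    have hNp : (0 : ℝ) < (supNorm (x - y) : ℝ) := by rw [← hN]; exact nrm_pos _
    rw [hN]
    calc |Ggh n a (x + unitVec κ) y () () - Ggh n a x y () ()|
        ≤ ghA1 a * Real.exp (-(ghDelta a / n) * supNorm (x - y)) / ((n : ℝ) ^ 2 * (supNorm (x - y) : ℝ) ^ 3) := h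
      _ = ((n : ℝ) ^ 2)⁻¹ * ghA1 a * (Real.exp (-(ghDelta a / n) * supNorm (x - y)) / (supNorm (x - y) : ℝ) ^ 3) := by
          field_simp
      _ ≤ ((n : ℝ) ^ 2)⁻¹ * (ghA1 a + 2 * (cG0 4 + cSplit 4 a)) * (Real.exp (-(ghDelta a / n) * supNorm (x - y)) / (supNorm (x - y) : ℝ) ^ 3) :=
          mul_le_mul_of_nonneg_right (mul_le_mul_of_nonneg_left (by linarith) (by positivity)) (by positivity)

/-- [folklore] **THE COLUMN DIFFERENCE** (by `Ggh_symm`): `|Ggh y (x+e_κ) − Ggh y x| ≤ n⁻²·A₁·e(x−y)∕nrm(x−y)³`. -/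
theorem abs_Ggh_colDiff_le_env (ha : 0 < a) (x y : Pt) (κ : Fin 4) :
    |Ggh n a y (x + unitVec κ) () () - Ggh n a y x () ()|
      ≤ ((n : ℝ) ^ 2)⁻¹ * (ghA1 a + 2 * (cG0 4 + cSplit 4 a)) * (Real.exp (-(ghDelta a / n) * supNorm (x - y)) / nrm (x - y) ^ 3) := by
  rw [Ggh_symm n a ha y (x + unitVec κ) () (), Ggh_symm n a ha y x () ()]
  exact abs_Ggh_rowDiff_le_env n ha x y κ

/-! ## §2 The needle-weighted leg sums and the block sums -/

section Sums

variable (ha : 0 < a) (S : Finset Pt) (q : Pt → ℝ)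
include ha

/-- [folklore] `γ(y) := Σ_{x∈S} Ggh x y·q x`: `|γ(y)| ≤ Σ_{x∈S} |q x|·(n⁻²·A₀·e(y−x)∕nrm(y−x)²)`. -/
theorem abs_gam_le (y : Pt) :
    |∑ x ∈ S, Ggh n a x y () () * q x|
      ≤ ∑ x ∈ S, |q x| * (((n : ℝ) ^ 2)⁻¹ * (ghA0 a + (cG0 4 + cSplit 4 a)) * (Real.exp (-(ghDelta a / n) * supNorm (y - x)) / nrm (y - x) ^ 2)) := by
  refine (Finset.abs_sum_le_sum_abs _ _).trans (Finset.sum_le_sum fun x _ => ?_)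
  rw [abs_mul, mul_comm]
  refine mul_le_mul_of_nonneg_left ?_ (abs_nonneg _)
  rw [← env_symm' n 2 x y]
  exact abs_Ggh_le_env n ha x y

/-- [folklore] `|γ(y+e_κ) − γ(y)| ≤ Σ_{x∈S} |q x|·(n⁻²·A₁·e(y−x)∕nrm(y−x)³)` (column difference of the leg). -/
theorem abs_gam_diff_le (y : Pt) (κ : Fin 4) :
    |∑ x ∈ S, Ggh n a x (y + unitVec κ) () () * q x - ∑ x ∈ S, Ggh n a x y () () * q x|
      ≤ ∑ x ∈ S, |q x| * (((n : ℝ) ^ 2)⁻¹ * (ghA1 a + 2 * (cG0 4 + cSplit 4 a)) * (Real.exp (-(ghDelta a / n) * supNorm (y - x)) / nrm (y - x) ^ 3)) := by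
  rw [← Finset.sum_sub_distrib]
  refine (Finset.abs_sum_le_sum_abs _ _).trans (Finset.sum_le_sum fun x _ => ?_)
  rw [← sub_mul, abs_mul, mul_comm]
  refine mul_le_mul_of_nonneg_left ?_ (abs_nonneg _)
  exact abs_Ggh_colDiff_le_env n ha y x κ

/-- [folklore] `ρ(y) := Σ_{t∈S} Ggh y t·q t`: `|ρ(y)| ≤ Σ_{t∈S} |q t|·(n⁻²·A₀·e(y−t)∕nrm(y−t)²)`. -/
theorem abs_rho_le (y : Pt) :
    |∑ t ∈ S, Ggh n a y t () () * q t|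
      ≤ ∑ t ∈ S, |q t| * (((n : ℝ) ^ 2)⁻¹ * (ghA0 a + (cG0 4 + cSplit 4 a)) * (Real.exp (-(ghDelta a / n) * supNorm (y - t)) / nrm (y - t) ^ 2)) := by
  refine (Finset.abs_sum_le_sum_abs _ _).trans (Finset.sum_le_sum fun t _ => ?_)
  rw [abs_mul, mul_comm]
  exact mul_le_mul_of_nonneg_left (abs_Ggh_le_env n ha y t) (abs_nonneg _)

/-- [folklore] `|ρ(y+e_κ) − ρ(y)| ≤ Σ_{t∈S} |q t|·(n⁻²·A₁·e(y−t)∕nrm(y−t)³)` (row difference of the leg). -/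
theorem abs_rho_diff_le (y : Pt) (κ : Fin 4) :
    |∑ t ∈ S, Ggh n a (y + unitVec κ) t () () * q t - ∑ t ∈ S, Ggh n a y t () () * q t|
      ≤ ∑ t ∈ S, |q t| * (((n : ℝ) ^ 2)⁻¹ * (ghA1 a + 2 * (cG0 4 + cSplit 4 a)) * (Real.exp (-(ghDelta a / n) * supNorm (y - t)) / nrm (y - t) ^ 3)) := by
  rw [← Finset.sum_sub_distrib]
  refine (Finset.abs_sum_le_sum_abs _ _).trans (Finset.sum_le_sum fun t _ => ?_)
  rw [← sub_mul, abs_mul, mul_comm]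
  exact mul_le_mul_of_nonneg_left (abs_Ggh_rowDiff_le_env n ha y t κ) (abs_nonneg _)

end Sums

/-- [folklore] The block ROW sum `R(y) := Σ_{t∈B β} Ggh y t`: `|R(y)| ≤ cNear a` (M10). -/
theorem abs_R_le (ha : 0 < a) (y β : Pt) : |∑ t ∈ B (n - 1) β, Ggh n a y t () ()| ≤ cNear a := by
  refine (Finset.abs_sum_le_sum_abs _ _).trans ((sum_B_abs_Ggh_le n ha y β).trans ?_)
  have h0 := cNear_nonneg ha
  have h1 : Real.exp (-(ghDelta a * dist (blk (n - 1) y) β)) ≤ 1 :=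
    Real.exp_le_one_iff.2 (by have := ghDelta_pos ha; have := @dist_nonneg _ _ (blk (n - 1) y) β; nlinarith)
  calc cNear a * Real.exp (-(ghDelta a * dist (blk (n - 1) y) β)) ≤ cNear a * 1 := mul_le_mul_of_nonneg_left h1 h0
    _ = cNear a := mul_one _

/-- [folklore] `|R(y+e_κ) − R(y)| ≤ cNear1 a ∕ n` (M10-d1). -/
theorem abs_R_diff_le (ha : 0 < a) (y β : Pt) (κ : Fin 4) :
    |∑ t ∈ B (n - 1) β, Ggh n a (y + unitVec κ) t () () - ∑ t ∈ B (n - 1) β, Ggh n a y t () ()| ≤ cNear1 a / n := by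
  have hn : (0 : ℝ) < n := by exact_mod_cast Nat.pos_of_ne_zero (NeZero.ne n)
  rw [← Finset.sum_sub_distrib]
  refine (Finset.abs_sum_le_sum_abs _ _).trans ((sum_B_abs_Ggh_diff_le n ha y β κ).trans ?_)
  have h0 : 0 ≤ cNear1 a / n := by
    have h := sum_B_abs_Ggh_diff_le n ha (0 : Pt) (blk (n - 1) (0 : Pt)) κ
    rw [dist_self, mul_zero, neg_zero, Real.exp_zero, mul_one] at h
    exact le_trans (Finset.sum_nonneg fun _ _ => abs_nonneg _) h
  have h1 : Real.exp (-(ghDelta a * dist (blk (n - 1) y) β)) ≤ 1 :=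
    Real.exp_le_one_iff.2 (by have := ghDelta_pos ha; have := @dist_nonneg _ _ (blk (n - 1) y) β; nlinarith)
  calc cNear1 a / n * Real.exp (-(ghDelta a * dist (blk (n - 1) y) β)) ≤ cNear1 a / n * 1 := mul_le_mul_of_nonneg_left h1 h0
    _ = cNear1 a / n := mul_one _

/-- [folklore] The block COLUMN sum `C(y) := Σ_{x∈B β} Ggh x y`: `|C(y)| ≤ cNear a` (M10 by `Ggh_symm`). -/
theorem abs_C_le (ha : 0 < a) (y β : Pt) : |∑ x ∈ B (n - 1) β, Ggh n a x y () ()| ≤ cNear a := by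
  have e : ∑ x ∈ B (n - 1) β, Ggh n a x y () () = ∑ x ∈ B (n - 1) β, Ggh n a y x () () :=
    Finset.sum_congr rfl fun x _ => Ggh_symm n a ha x y () ()
  rw [e]; exact abs_R_le n ha y β

/-- [folklore] `|C(y+e_κ) − C(y)| ≤ cNear1 a ∕ n` (M10-d1, column twin). -/
theorem abs_C_diff_le (ha : 0 < a) (y β : Pt) (κ : Fin 4) :
    |∑ x ∈ B (n - 1) β, Ggh n a x (y + unitVec κ) () () - ∑ x ∈ B (n - 1) β, Ggh n a x y () ()| ≤ cNear1 a / n := by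
  have hn : (0 : ℝ) < n := by exact_mod_cast Nat.pos_of_ne_zero (NeZero.ne n)
  rw [← Finset.sum_sub_distrib]
  refine (Finset.abs_sum_le_sum_abs _ _).trans ((sum_B_abs_Ggh_diff_col_le n ha y β κ).trans ?_)
  have h0 : 0 ≤ cNear1 a / n := by
    have h := sum_B_abs_Ggh_diff_le n ha (0 : Pt) (blk (n - 1) (0 : Pt)) κ
    rw [dist_self, mul_zero, neg_zero, Real.exp_zero, mul_one] at h
    exact le_trans (Finset.sum_nonneg fun _ _ => abs_nonneg _) h
  have h1 : Real.exp (-(ghDelta a * dist (blk (n - 1) y) β)) ≤ 1 :=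
    Real.exp_le_one_iff.2 (by have := ghDelta_pos ha; have := @dist_nonneg _ _ (blk (n - 1) y) β; nlinarith)
  calc cNear1 a / n * Real.exp (-(ghDelta a * dist (blk (n - 1) y) β)) ≤ cNear1 a / n * 1 := mul_le_mul_of_nonneg_left h1 h0
    _ = cNear1 a / n := mul_one _

/-! ## §3 The dipole regrouping and the two words -/

/-- [folklore] **THE DIPOLE REGROUPING** of the closed form `R₀γ₁ − ρ₀C₁ − R₁γ₀ + ρ₁C₀` across the current's bond:
`= R₀(γ₁ − γ₀) − (R₁ − R₀)γ₀ − ρ₀(C₁ − C₀) + (ρ₁ − ρ₀)C₀`. -/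
theorem dipole_regroup (R₀ R₁ γ₀ γ₁ ρ₀ ρ₁ C₀ C₁ : ℝ) :
    R₀ * γ₁ - ρ₀ * C₁ - R₁ * γ₀ + ρ₁ * C₀ = R₀ * (γ₁ - γ₀) - (R₁ - R₀) * γ₀ - ρ₀ * (C₁ - C₀) + (ρ₁ - ρ₀) * C₀ := by ring

/-- [folklore] Four products, each `|a|·|b|` with one factor a block sum (`≤ M`, `≤ M′`) and one a needle sum (envelope). -/
theorem abs_four_le {R₀ dγ dR γ₀ ρ₀ dC dρ C₀ M M' Γ₂ Γ₃ : ℝ} (hR : |R₀| ≤ M) (hdγ : |dγ| ≤ Γ₃) (hdR : |dR| ≤ M') (hγ : |γ₀| ≤ Γ₂)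
    (hρ : |ρ₀| ≤ Γ₂) (hdC : |dC| ≤ M') (hdρ : |dρ| ≤ Γ₃) (hC : |C₀| ≤ M) :
    |R₀ * dγ - dR * γ₀ - ρ₀ * dC + dρ * C₀| ≤ 2 * (M * Γ₃ + M' * Γ₂) := by
  have h1 : |R₀ * dγ| ≤ M * Γ₃ := by rw [abs_mul]; exact mul_le_mul hR hdγ (abs_nonneg _) ((abs_nonneg _).trans hR)
  have h2 : |dR * γ₀| ≤ M' * Γ₂ := by rw [abs_mul]; exact mul_le_mul hdR hγ (abs_nonneg _) ((abs_nonneg _).trans hdR)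
  have h3 : |ρ₀ * dC| ≤ Γ₂ * M' := by rw [abs_mul]; exact mul_le_mul hρ hdC (abs_nonneg _) ((abs_nonneg _).trans hρ)
  have h4 : |dρ * C₀| ≤ Γ₃ * M := by rw [abs_mul]; exact mul_le_mul hdρ hC (abs_nonneg _) ((abs_nonneg _).trans hdρ)
  calc |R₀ * dγ - dR * γ₀ - ρ₀ * dC + dρ * C₀| ≤ |R₀ * dγ - dR * γ₀ - ρ₀ * dC| + |dρ * C₀| := abs_add_le _ _
    _ ≤ |R₀ * dγ - dR * γ₀| + |ρ₀ * dC| + |dρ * C₀| := by linarith [abs_sub (R₀ * dγ - dR * γ₀) (ρ₀ * dC)]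
    _ ≤ |R₀ * dγ| + |dR * γ₀| + |ρ₀ * dC| + |dρ * C₀| := by linarith [abs_sub (R₀ * dγ) (dR * γ₀)]
    _ ≤ M * Γ₃ + M' * Γ₂ + Γ₂ * M' + Γ₃ * M := by linarith
    _ = 2 * (M * Γ₃ + M' * Γ₂) := by ring

/-- [folklore] **THE WORD `ghCur ⊗ qA` OVER THE GHOST LEGS, POINTWISE, FROM A NEEDLE-SITE ENVELOPE** (T₄; current at `(κ, p)`, rooted needle at `(λ, u)`): for every
root `ρ`, `|biBubbleTable (Ggh n a) (Ggh n a) ghCur (qAntiAt ρ n) κ λ p u| ≤ Σ_{x ∈ B(blk u)} |qJetAt ρ n λ u (blk u) x| · G(p − x)` with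
`G(v) := n⁻²·(cNear a·A₁·e(v)∕nrm v³ + (cNear1 a∕n)·A₀·e(v)∕nrm v²)`. -/
theorem abs_T₄_le_needle_env (ha : 0 < a) (ρ : Site 4) (κ lam : Fin 4) (p u : Site 4) :
    |biBubbleTable (Ggh n a) (Ggh n a) ghCur (qAntiAt ρ n) κ lam p u|
      ≤ ∑ x ∈ B (n - 1) (blk (n - 1) u), |qJetAt ρ n lam u (blk (n - 1) u) x| *
          (((n : ℝ) ^ 2)⁻¹ * (cNear a * (ghA1 a + 2 * (cG0 4 + cSplit 4 a)) * (Real.exp (-(ghDelta a / n) * supNorm (p - x)) / nrm (p - x) ^ 3)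
            + cNear1 a / n * (ghA0 a + (cG0 4 + cSplit 4 a)) * (Real.exp (-(ghDelta a / n) * supNorm (p - x)) / nrm (p - x) ^ 2))) := by
  set Bu := B (n - 1) (blk (n - 1) u) with hBu
  set q : Pt → ℝ := fun x => qJetAt ρ n lam u (blk (n - 1) u) x with hq
  -- the eight letters
  have hR := abs_R_le n ha p (blk (n - 1) u)
  have hC := abs_C_le n ha p (blk (n - 1) u)
  have hdR := abs_R_diff_le n ha p (blk (n - 1) u) κ
  have hdC := abs_C_diff_le n ha p (blk (n - 1) u) κ
  have hγ := abs_gam_le n ha Bu q p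
  have hdγ := abs_gam_diff_le n ha Bu q p κ
  have hρ := abs_rho_le n ha Bu q p
  have hdρ := abs_rho_diff_le n ha Bu q p κ
  rw [biBubbleTable_ghCur_qAntiAt_eq, abs_mul, show |(-(1 / 2 : ℝ))| = 1 / 2 by norm_num, dipole_regroup]
  have key := abs_four_le hR hdγ hdR hγ hρ hdC hdρ hC
  refine (mul_le_mul_of_nonneg_left key (by norm_num)).trans (le_of_eq ?_)
  rw [show (1 / 2 : ℝ) * (2 * (cNear a * ∑ x ∈ Bu, |q x| * (((n : ℝ) ^ 2)⁻¹ * (ghA1 a + 2 * (cG0 4 + cSplit 4 a)) *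
        (Real.exp (-(ghDelta a / n) * supNorm (p - x)) / nrm (p - x) ^ 3))
      + cNear1 a / n * ∑ x ∈ Bu, |q x| * (((n : ℝ) ^ 2)⁻¹ * (ghA0 a + (cG0 4 + cSplit 4 a)) *
        (Real.exp (-(ghDelta a / n) * supNorm (p - x)) / nrm (p - x) ^ 2))))
      = cNear a * ∑ x ∈ Bu, |q x| * (((n : ℝ) ^ 2)⁻¹ * (ghA1 a + 2 * (cG0 4 + cSplit 4 a)) *
        (Real.exp (-(ghDelta a / n) * supNorm (p - x)) / nrm (p - x) ^ 3))
      + cNear1 a / n * ∑ x ∈ Bu, |q x| * (((n : ℝ) ^ 2)⁻¹ * (ghA0 a + (cG0 4 + cSplit 4 a)) *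
        (Real.exp (-(ghDelta a / n) * supNorm (p - x)) / nrm (p - x) ^ 2)) by ring,
    Finset.mul_sum, Finset.mul_sum, ← Finset.sum_add_distrib]
  exact Finset.sum_congr rfl fun x _ => by ring

/-- [folklore] **THE MIRROR WORD `qA ⊗ ghCur`** (T₅; rooted needle at `(λ, u)` on the first line, current at `(κ, p)` on the second): the same envelope. -/
theorem abs_T₅_le_needle_env (ha : 0 < a) (ρ : Site 4) (κ lam : Fin 4) (p u : Site 4) :
    |biBubbleTable (Ggh n a) (Ggh n a) (qAntiAt ρ n) ghCur lam κ u p|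
      ≤ ∑ x ∈ B (n - 1) (blk (n - 1) u), |qJetAt ρ n lam u (blk (n - 1) u) x| *
          (((n : ℝ) ^ 2)⁻¹ * (cNear a * (ghA1 a + 2 * (cG0 4 + cSplit 4 a)) * (Real.exp (-(ghDelta a / n) * supNorm (p - x)) / nrm (p - x) ^ 3)
            + cNear1 a / n * (ghA0 a + (cG0 4 + cSplit 4 a)) * (Real.exp (-(ghDelta a / n) * supNorm (p - x)) / nrm (p - x) ^ 2))) := by
  set Bu := B (n - 1) (blk (n - 1) u) with hBu
  set q : Pt → ℝ := fun x => qJetAt ρ n lam u (blk (n - 1) u) x with hq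
  -- rows of the first leg at `p`, `p + e_κ`; needle-weighted columns of the second leg
  have hR := abs_R_le n ha p (blk (n - 1) u)
  have hdR := abs_R_diff_le n ha p (blk (n - 1) u) κ
  have hC := abs_C_le n ha p (blk (n - 1) u)
  have hdC := abs_C_diff_le n ha p (blk (n - 1) u) κ
  have hρ := abs_rho_le n ha Bu q p
  have hdρ := abs_rho_diff_le n ha Bu q p κ
  -- `γ′(y) := Σ_{z∈B} q z·Ggh z y` = `γ(y)` with the factors commuted
  have eγ : ∀ y : Pt, ∑ z ∈ Bu, q z * Ggh n a z y () () = ∑ z ∈ Bu, Ggh n a z y () () * q z :=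
    fun y => Finset.sum_congr rfl fun z _ => mul_comm _ _
  have hγ := abs_gam_le n ha Bu q p
  rw [← eγ p] at hγ
  have hdγ := abs_gam_diff_le n ha Bu q p κ
  rw [← eγ (p + unitVec κ), ← eγ p] at hdγ
  rw [biBubbleTable_qAntiAt_ghCur_eq, abs_mul, show |(-(1 / 2 : ℝ))| = 1 / 2 by norm_num, dipole_regroup]
  have key := abs_four_le hR hdγ hdR hγ hρ hdC hdρ hC
  refine (mul_le_mul_of_nonneg_left key (by norm_num)).trans (le_of_eq ?_)
  rw [show (1 / 2 : ℝ) * (2 * (cNear a * ∑ x ∈ Bu, |q x| * (((n : ℝ) ^ 2)⁻¹ * (ghA1 a + 2 * (cG0 4 + cSplit 4 a)) *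
        (Real.exp (-(ghDelta a / n) * supNorm (p - x)) / nrm (p - x) ^ 3))
      + cNear1 a / n * ∑ x ∈ Bu, |q x| * (((n : ℝ) ^ 2)⁻¹ * (ghA0 a + (cG0 4 + cSplit 4 a)) *
        (Real.exp (-(ghDelta a / n) * supNorm (p - x)) / nrm (p - x) ^ 2))))
      = cNear a * ∑ x ∈ Bu, |q x| * (((n : ℝ) ^ 2)⁻¹ * (ghA1 a + 2 * (cG0 4 + cSplit 4 a)) *
        (Real.exp (-(ghDelta a / n) * supNorm (p - x)) / nrm (p - x) ^ 3))
      + cNear1 a / n * ∑ x ∈ Bu, |q x| * (((n : ℝ) ^ 2)⁻¹ * (ghA0 a + (cG0 4 + cSplit 4 a)) *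
        (Real.exp (-(ghDelta a / n) * supNorm (p - x)) / nrm (p - x) ^ 2)) by ring,
    Finset.mul_sum, Finset.mul_sum, ← Finset.sum_add_distrib]
  exact Finset.sum_congr rfl fun x _ => by ring

end Summit.QuantumFields.BalabanUV.Beta.D1BFx.NeedleGhostDipoleWord

end
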